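import Mathlib.RingTheory.PowerSeries.Inverse
import Mathlib.RingTheory.PowerSeries.Ideal
import Mathlib.RingTheory.MvPowerSeries.Basic
import Mathlib.RingTheory.LocalRing.ResidueField.Basic
import Mathlib.Algebra.CharP.Algebra
import Mathlib.NumberTheory.Padics.RingHoms
import Literature.NumberTheory.GaloisRepresentations.PotentialDiagonalizabilityCriteriaProofs
import HarnessLib

/-!
# The two-variable Iwasawa algebra `Λ₂ = ℤ_p⟦T₂⟧⟦T₁⟧`: it IS `ℤ_p⟦T₁, T₂⟧`
# (`PowerSeries (PowerSeries R) ≃+* MvPowerSeries (Fin 2) R`), and its residue field is `𝔽_p`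

Topic `Literature/NumberTheory/IwasawaTheory` (cell `bsd-eis`, planner RULING L50 (2); KERNEL-MAP
§1 items "K-iso" and the `R = Λ` standing clauses of Prop. 4.1.1): the tree's receptacle for the two-variable Iwasawa algebra is the NESTED ring
`IwasawaAlgebra₂ p = PowerSeries (PowerSeries ℤ_[p])` (`Rubin1991/TwoVariableMainConjecture.lean`:
OUTER variable `T₁ = PowerSeries.X`, INNER variable `T₂ = C X`), while the named facts of
Greenberg 2006/2016 (`Greenberg2016.prop411_selmer_isAlmostDivisible`, `prop422_…`,
`Greenberg2006.prop41_…`, `prop42_…`, `sec5A_…`) quantify over a coefficient ring `Λ` with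
`Nonempty (Λ ≃+* MvPowerSeries (Fin m) ℤ_[p])` ([Greenberg2016Selmer] p. 4 L11: "`Λ` is isomorphic to
a formal power series ring over `ℤ_p` … in a finite number of variables"; [Greenberg2010] §5 PDF
p. 26 L1–2: "one can define an isomorphism from `Λ` to the formal power series ring
`ℤ_p[[x_1, …, x_m]]` by sending `x_i` to `γ_i − 1`"). This file supplies the missing identification
for `m = 2` — Mathlib has no iterated-versus-multivariate power series equivalence (only
`MvPowerSeries.toAdicCompletionAlgEquiv`; its substitution API cannot be used because the inner
variable `C X` has the non-nilpotent constant coefficient `X`) — by the coefficient bijection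
`[T₁^i T₂^j] F = coeff j (coeff i F) ↔ coeff (i, j)`, multiplicative because both products are the
Cauchy product over the antidiagonal (`Finset.sum_nbij'` between `antidiagonal d` in `Fin 2 →₀ ℕ` and
`antidiagonal (d 0) ×ˢ antidiagonal (d 1)`). §2 then records the STANDING CLAUSES the facts ask of
`R = Λ = Λ₂` ([Greenberg2016Selmer] p. 4 L5–10: "`R` is a complete Noetherian local ring with finite
residue field of characteristic `p`"; typed in `prop411_…` as `[IsLocalRing R] [IsNoetherianRing R]`,
`IsAdicComplete (maximalIdeal R) R`, `Finite (ResidueField R)`, `CharP (ResidueField R) p`): the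
residue field of `R⟦X⟧` over a local `R` is that of `R` (`residueFieldPowerSeriesEquiv`, through the
surjection `residue ∘ constantCoeff` whose kernel is the maximal ideal — Mathlib's
`PowerSeries.residueFieldOfPowerSeries` covers only a FIELD of coefficients), hence
`ResidueField (ℤ_p⟦T₂⟧⟦T₁⟧) ≃+* ZMod p` (`residueFieldIwasawaAlgebraTwoVarEquiv`), finite of
characteristic `p`; locality and Noetherianity are Mathlib instances, recorded as theorems. PROVED,
no named fact, no `instance` declaration, no notation.

`(p, T₁, T₂)`-adic COMPLETENESS — the clause `IsAdicComplete (maximalIdeal R) R` — is the tree's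
theorem `GaloisRepresentations.powerSeries_isAdicComplete_maximalIdeal` ("power series over a
complete local ring are complete for the maximal ideal", [Bourbaki1989CommAlg] Ch. III §2 no. 6
Prop. 6) applied twice over Mathlib's `IsAdicComplete (maximalIdeal ℤ_[p]) ℤ_[p]`
(`isAdicComplete_maximalIdeal_iwasawaAlgebraTwoVar`); that module is imported (REUSED, not
re-proved; it is already in the import closure of the route's `EisensteinPrimesTwoVariableWeierstrass`).
So ALL the `R = Λ = Λ₂` standing clauses of `prop411_selmer_isAlmostDivisible` /
`prop422_localCohomology_isAlmostDivisible` / `prop41_…` / `prop42_…` / `sec5A_…` are available as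
theorems here (no GAP left on the coefficient-ring side).

## Main definitions and results

* `finTwoExp i j : Fin 2 →₀ ℕ` — the exponent vector `(i, j)`, with `finTwoExp_apply_zero/one`,
  `finTwoExp_eq`, `finTwoExp_add`.
* `nestedPowerSeriesEquiv R : PowerSeries (PowerSeries R) ≃+* MvPowerSeries (Fin 2) R` with
  `coeff_nestedPowerSeriesEquiv` (`coeff d (e F) = coeff (d 1) (coeff (d 0) F)`),
  `coeff_coeff_nestedPowerSeriesEquiv_symm`, and the dictionary `nestedPowerSeriesEquiv_X`
  (`T₁ = X ↦ X 0`), `nestedPowerSeriesEquiv_C_X` (`T₂ = C X ↦ X 1`), `nestedPowerSeriesEquiv_C_C`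
  (`C (C r) ↦ C r`).
* `nonempty_ringEquiv_mvPowerSeries_fin_two` — the clause `Nonempty (Λ₂ ≃+* MvPowerSeries (Fin 2) R)`
  of the named facts, for `Λ₂ = PowerSeries (PowerSeries R)`.
* `ker_residue_comp_constantCoeff`, `residueFieldPowerSeriesEquiv : ResidueField R⟦X⟧ ≃+* ResidueField R`
  (`R` local), `residueFieldIwasawaAlgebraTwoVarEquiv p : ResidueField (ℤ_p⟦X⟧⟦X⟧) ≃+* ZMod p`,
  `finite_residueField_iwasawaAlgebraTwoVar`, `charP_residueField_iwasawaAlgebraTwoVar`,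
  `isLocalRing_iwasawaAlgebraTwoVar`, `isNoetherianRing_iwasawaAlgebraTwoVar`,
  `isAdicComplete_maximalIdeal_iwasawaAlgebraTwoVar` (§2).

## References

* [Greenberg2016Selmer] R. Greenberg, *On the structure of Selmer groups* (2016), §1 p. 4 L11–13.
* [Greenberg2010] R. Greenberg, Kyoto J. Math. 50 (2010), §5 (PDF p. 26 L1–2).
* [Rubin1991] K. Rubin, Invent. Math. 103 (1991), §4 p. 36 ("isomorphic to a power series ring in
  1 or 2 variables").
* [Bourbaki1989CommAlg] N. Bourbaki, *Commutative Algebra*, Ch. III §2 no. 6, Prop. 6 (completeness of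
  `A[[X₁,…,X_s]]`).
-/

noncomputable section

open Finset

namespace Literature.NumberTheory.IwasawaTheory

section FinTwo

/-- The exponent vector `(i, j) : Fin 2 →₀ ℕ` of the monomial `T₁^i T₂^j` (`x_1^i x_2^j` of
`ℤ_p[[x_1, x_2]]`). [cite: Greenberg2010, §5 (PDF p. 26 L1–2)] -/
def finTwoExp (i j : ℕ) : Fin 2 →₀ ℕ := Finsupp.single 0 i + Finsupp.single 1 j

/-- `(i, j)` at `0` is `i` (exponent bookkeeping for `ℤ_p[[x_1, x_2]]`). [cite: Greenberg2010, §5 (PDF p. 26 L1–2)] -/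
@[simp] theorem finTwoExp_apply_zero (i j : ℕ) : finTwoExp i j 0 = i := by
  simp [finTwoExp]

/-- `(i, j)` at `1` is `j`. [cite: Greenberg2010, §5 (PDF p. 26 L1–2)] -/
@[simp] theorem finTwoExp_apply_one (i j : ℕ) : finTwoExp i j 1 = j := by
  simp [finTwoExp]

/-- Every exponent vector on `Fin 2` is `(d 0, d 1)`. [cite: Greenberg2010, §5 (PDF p. 26 L1–2)] -/
@[simp] theorem finTwoExp_eq (d : Fin 2 →₀ ℕ) : finTwoExp (d 0) (d 1) = d := by
  ext s
  fin_cases s <;> simp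

/-- `(i + i', j + j') = (i, j) + (i', j')`. [cite: Greenberg2010, §5 (PDF p. 26 L1–2)] -/
theorem finTwoExp_add (i i' j j' : ℕ) :
    finTwoExp (i + i') (j + j') = finTwoExp i j + finTwoExp i' j' := by
  ext s
  fin_cases s <;> simp

/-- `(i, j) = (i', j')` iff `i = i'` and `j = j'`. [cite: Greenberg2010, §5 (PDF p. 26 L1–2)] -/
theorem finTwoExp_inj {i i' j j' : ℕ} : finTwoExp i j = finTwoExp i' j' ↔ i = i' ∧ j = j' := by
  constructor
  · intro h
    exact ⟨by simpa using congrArg (fun d ↦ d 0) h, by simpa using congrArg (fun d ↦ d 1) h⟩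
  · rintro ⟨rfl, rfl⟩
    rfl

end FinTwo

section Equiv

variable (R : Type*) [CommRing R]

/-- The coefficient map `F ↦ (d ↦ [T₂^{d 1}] ([T₁^{d 0}] F))` from the nested ring to `R⟦T₁, T₂⟧`.
[cite: Greenberg2010, §5 (PDF p. 26 L1–2)] -/
def nestedToMv (F : PowerSeries (PowerSeries R)) : MvPowerSeries (Fin 2) R :=
  fun d ↦ PowerSeries.coeff (d 1) (PowerSeries.coeff (d 0) F)

/-- The inverse coefficient map `G ↦ ∑ᵢ (∑ⱼ [T₁^i T₂^j]G · T₂^j) T₁^i`. [cite: Greenberg2010, §5 (PDF p. 26 L1–2)] -/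
def mvToNested (G : MvPowerSeries (Fin 2) R) : PowerSeries (PowerSeries R) :=
  PowerSeries.mk fun i ↦ PowerSeries.mk fun j ↦ MvPowerSeries.coeff (finTwoExp i j) G

variable {R}

/-- Coefficients of `nestedToMv`. [cite: Greenberg2010, §5 (PDF p. 26 L1–2)] -/
@[simp] theorem coeff_nestedToMv (F : PowerSeries (PowerSeries R)) (d : Fin 2 →₀ ℕ) :
    MvPowerSeries.coeff d (nestedToMv R F) = PowerSeries.coeff (d 1) (PowerSeries.coeff (d 0) F) :=
  rfl

/-- Coefficients of `mvToNested`. [cite: Greenberg2010, §5 (PDF p. 26 L1–2)] -/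
@[simp] theorem coeff_coeff_mvToNested (G : MvPowerSeries (Fin 2) R) (i j : ℕ) :
    PowerSeries.coeff j (PowerSeries.coeff i (mvToNested R G)) =
      MvPowerSeries.coeff (finTwoExp i j) G := by
  simp [mvToNested, PowerSeries.coeff_mk]

/-- `nestedToMv` is multiplicative: both sides are the Cauchy product over the antidiagonal — of
`d` in `Fin 2 →₀ ℕ` on the right, of `d 0` and then `d 1` in `ℕ` on the left; the bijection is
`(e, e') ↦ ((e 0, e' 0), (e 1, e' 1))`. [cite: Greenberg2010, §5 (PDF p. 26 L1–2)] -/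
theorem nestedToMv_mul (F F' : PowerSeries (PowerSeries R)) :
    nestedToMv R (F * F') = nestedToMv R F * nestedToMv R F' := by
  ext d
  rw [coeff_nestedToMv, MvPowerSeries.coeff_mul, PowerSeries.coeff_mul, map_sum]
  simp_rw [PowerSeries.coeff_mul]
  rw [← Finset.sum_product (antidiagonal (d 0)) (antidiagonal (d 1))
    (fun x : (ℕ × ℕ) × (ℕ × ℕ) ↦ PowerSeries.coeff x.2.1 (PowerSeries.coeff x.1.1 F) *
      PowerSeries.coeff x.2.2 (PowerSeries.coeff x.1.2 F'))]
  refine Finset.sum_nbij'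
    (fun x : (ℕ × ℕ) × (ℕ × ℕ) ↦ (finTwoExp x.1.1 x.2.1, finTwoExp x.1.2 x.2.2))
    (fun e : (Fin 2 →₀ ℕ) × (Fin 2 →₀ ℕ) ↦ ((e.1 0, e.2 0), (e.1 1, e.2 1)))
    (fun x hx ↦ ?_) (fun e he ↦ ?_) (fun x _ ↦ ?_) (fun e _ ↦ ?_) (fun x _ ↦ ?_)
  · -- lands in the antidiagonal of `d`
    rw [Finset.mem_product, HasAntidiagonal.mem_antidiagonal, HasAntidiagonal.mem_antidiagonal] at hx
    rw [HasAntidiagonal.mem_antidiagonal, ← finTwoExp_add, hx.1, hx.2, finTwoExp_eq]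
  · -- comes from the product of the two antidiagonals
    rw [HasAntidiagonal.mem_antidiagonal] at he
    rw [Finset.mem_product, HasAntidiagonal.mem_antidiagonal, HasAntidiagonal.mem_antidiagonal,
      ← Finsupp.add_apply, ← Finsupp.add_apply, he]
    exact ⟨rfl, rfl⟩
  · simp
  · simp
  · simp

/-- **`R⟦T₂⟧⟦T₁⟧ ≃+* R⟦T₁, T₂⟧`**: the nested two-variable power series ring is the two-variable
power series ring, by the coefficient bijection `[T₂^j]([T₁^i] F) ↔ [T₁^i T₂^j]` ("isomorphic to a
formal power series ring … in a finite number of variables"; the identification the cell's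
`IwasawaAlgebra₂ p = PowerSeries (PowerSeries ℤ_[p])` needs to meet the clause
`Nonempty (Λ ≃+* MvPowerSeries (Fin m) ℤ_[p])` of the named facts).
[cite: Greenberg2016Selmer, §1 p. 4 L11–13] [cite: Greenberg2010, §5 (PDF p. 26 L1–2)] -/
def nestedPowerSeriesEquiv : PowerSeries (PowerSeries R) ≃+* MvPowerSeries (Fin 2) R where
  toFun := nestedToMv R
  invFun := mvToNested R
  left_inv F := by
    ext i j
    rw [coeff_coeff_mvToNested, coeff_nestedToMv, finTwoExp_apply_zero, finTwoExp_apply_one]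
  right_inv G := by
    ext d
    rw [coeff_nestedToMv, coeff_coeff_mvToNested, finTwoExp_eq]
  map_mul' := nestedToMv_mul
  map_add' F F' := by
    ext d
    simp only [coeff_nestedToMv, map_add]

/-- Coefficients of the equivalence: `[T₁^{d 0} T₂^{d 1}] (e F) = [T₂^{d 1}] ([T₁^{d 0}] F)`.
[cite: Greenberg2010, §5 (PDF p. 26 L1–2)] -/
@[simp] theorem coeff_nestedPowerSeriesEquiv (F : PowerSeries (PowerSeries R)) (d : Fin 2 →₀ ℕ) :
    MvPowerSeries.coeff d (nestedPowerSeriesEquiv F) =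
      PowerSeries.coeff (d 1) (PowerSeries.coeff (d 0) F) :=
  rfl

/-- Coefficients of the inverse: `[T₂^j]([T₁^i] (e⁻¹ G)) = [T₁^i T₂^j] G`. [cite: Greenberg2010, §5 (PDF p. 26 L1–2)] -/
@[simp] theorem coeff_coeff_nestedPowerSeriesEquiv_symm (G : MvPowerSeries (Fin 2) R) (i j : ℕ) :
    PowerSeries.coeff j (PowerSeries.coeff i ((nestedPowerSeriesEquiv (R := R)).symm G)) =
      MvPowerSeries.coeff (finTwoExp i j) G :=
  coeff_coeff_mvToNested G i j

/-- **The outer variable `T₁ = X` goes to `X 0`.** [cite: Greenberg2010, §5 (PDF p. 26 L1–2)] -/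
theorem nestedPowerSeriesEquiv_X :
    nestedPowerSeriesEquiv (PowerSeries.X : PowerSeries (PowerSeries R)) = MvPowerSeries.X 0 := by
  classical
  ext d
  rw [coeff_nestedPowerSeriesEquiv, PowerSeries.coeff_X, MvPowerSeries.coeff_X]
  by_cases h0 : d 0 = 1
  · rw [if_pos h0, PowerSeries.coeff_one]
    by_cases h1 : d 1 = 0
    · rw [if_pos h1, if_pos]
      rw [← finTwoExp_eq d, h0, h1]
      ext s; fin_cases s <;> simp
    · rw [if_neg h1, if_neg]
      intro hd
      exact h1 (by rw [hd]; simp)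
  · rw [if_neg h0, map_zero, if_neg]
    intro hd
    exact h0 (by rw [hd]; simp)

/-- **The inner variable `T₂ = C X` goes to `X 1`.** [cite: Greenberg2010, §5 (PDF p. 26 L1–2)] -/
theorem nestedPowerSeriesEquiv_C_X :
    nestedPowerSeriesEquiv (PowerSeries.C (PowerSeries.X : PowerSeries R)) = MvPowerSeries.X 1 := by
  classical
  ext d
  rw [coeff_nestedPowerSeriesEquiv, PowerSeries.coeff_C, MvPowerSeries.coeff_X]
  by_cases h0 : d 0 = 0
  · rw [if_pos h0, PowerSeries.coeff_X]
    by_cases h1 : d 1 = 1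
    · rw [if_pos h1, if_pos]
      rw [← finTwoExp_eq d, h0, h1]
      ext s; fin_cases s <;> simp
    · rw [if_neg h1, if_neg]
      intro hd
      exact h1 (by rw [hd]; simp)
  · rw [if_neg h0, map_zero, if_neg]
    intro hd
    exact h0 (by rw [hd]; simp)

/-- **Constants `C (C r)` go to `C r`.** [cite: Greenberg2010, §5 (PDF p. 26 L1–2)] -/
theorem nestedPowerSeriesEquiv_C_C (r : R) :
    nestedPowerSeriesEquiv (PowerSeries.C (PowerSeries.C r : PowerSeries R)) = MvPowerSeries.C r := by
  classical
  ext d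
  rw [coeff_nestedPowerSeriesEquiv, PowerSeries.coeff_C, MvPowerSeries.coeff_C]
  by_cases h0 : d 0 = 0
  · rw [if_pos h0, PowerSeries.coeff_C]
    by_cases h1 : d 1 = 0
    · rw [if_pos h1, if_pos]
      rw [← finTwoExp_eq d, h0, h1]
      ext s; fin_cases s <;> simp
    · rw [if_neg h1, if_neg]
      intro hd
      exact h1 (by rw [hd]; simp)
  · rw [if_neg h0, map_zero, if_neg]
    intro hd
    exact h0 (by rw [hd]; simp)

variable (R) in
/-- The clause of the named facts: `Nonempty (R⟦T₂⟧⟦T₁⟧ ≃+* MvPowerSeries (Fin 2) R)`.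
[cite: Greenberg2016Selmer, §1 p. 4 L11–13] -/
theorem nonempty_ringEquiv_mvPowerSeries_fin_two :
    Nonempty (PowerSeries (PowerSeries R) ≃+* MvPowerSeries (Fin 2) R) :=
  ⟨nestedPowerSeriesEquiv⟩

end Equiv

/-! ## §2. The standing clauses for `R = Λ₂`: residue field `𝔽_p`, local, Noetherian -/

section Residue

open IsLocalRing

variable {R : Type*} [CommRing R] [IsLocalRing R]

/-- The kernel of `R⟦X⟧ → R → k_R` (`residue ∘ constantCoeff`) is the maximal ideal of `R⟦X⟧`: a
power series is a unit iff its constant coefficient is. [cite: Greenberg2016Selmer, §1 p. 4 L5–10 (R … local ring with finite residue field)] -/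
theorem ker_residue_comp_constantCoeff :
    RingHom.ker ((residue R).comp (PowerSeries.constantCoeff (R := R))) =
      maximalIdeal (PowerSeries R) := by
  ext f
  rw [RingHom.mem_ker, RingHom.comp_apply, residue_eq_zero_iff, mem_maximalIdeal,
    mem_maximalIdeal, mem_nonunits_iff, mem_nonunits_iff, PowerSeries.isUnit_iff_constantCoeff]

/-- `R⟦X⟧ → R → k_R` is onto. [cite: Greenberg2016Selmer, §1 p. 4 L5–10] -/
theorem residue_comp_constantCoeff_surjective :
    Function.Surjective ((residue R).comp (PowerSeries.constantCoeff (R := R))) :=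
  residue_surjective.comp fun r ↦ ⟨PowerSeries.C r, PowerSeries.constantCoeff_C r⟩

/-- **The residue field of `R⟦X⟧` is the residue field of `R`** (`R` local): the first
isomorphism theorem for `residue ∘ constantCoeff`. (Mathlib's `PowerSeries.residueFieldOfPowerSeries`
is the case of a field `R`.) [cite: Greenberg2016Selmer, §1 p. 4 L5–10 (R complete Noetherian local, finite residue field of characteristic p)] -/
def residueFieldPowerSeriesEquiv : ResidueField (PowerSeries R) ≃+* ResidueField R :=
  (Ideal.quotEquivOfEq (ker_residue_comp_constantCoeff (R := R)).symm).trans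
    (RingHom.quotientKerEquivOfSurjective residue_comp_constantCoeff_surjective)

variable (p : ℕ) [Fact p.Prime]

/-- **The residue field of `Λ₂ = ℤ_p⟦T₂⟧⟦T₁⟧` is `𝔽_p`**: twice `residueFieldPowerSeriesEquiv`, then
`ℤ_p/pℤ_p ≃ ZMod p` (`PadicInt.residueField`). [cite: Greenberg2016Selmer, §1 p. 4 L5–10] -/
def residueFieldIwasawaAlgebraTwoVarEquiv :
    ResidueField (PowerSeries (PowerSeries ℤ_[p])) ≃+* ZMod p :=
  (residueFieldPowerSeriesEquiv (R := PowerSeries ℤ_[p])).trans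
    ((residueFieldPowerSeriesEquiv (R := ℤ_[p])).trans (PadicInt.residueField (p := p)))

/-- The clause `Finite (ResidueField R)` for `R = Λ₂`. [cite: Greenberg2016Selmer, §1 p. 4 L5–10] -/
theorem finite_residueField_iwasawaAlgebraTwoVar :
    Finite (ResidueField (PowerSeries (PowerSeries ℤ_[p]))) :=
  Finite.of_equiv _ (residueFieldIwasawaAlgebraTwoVarEquiv p).symm.toEquiv

/-- The clause `CharP (ResidueField R) p` for `R = Λ₂`. [cite: Greenberg2016Selmer, §1 p. 4 L5–10] -/
theorem charP_residueField_iwasawaAlgebraTwoVar :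
    CharP (ResidueField (PowerSeries (PowerSeries ℤ_[p]))) p :=
  charP_of_injective_ringHom (f := (residueFieldIwasawaAlgebraTwoVarEquiv p).symm.toRingHom)
    (residueFieldIwasawaAlgebraTwoVarEquiv p).symm.injective p

/-- The clause `IsLocalRing R` for `R = Λ₂` (Mathlib instance, recorded). [cite: Greenberg2016Selmer, §1 p. 4 L5–10] -/
theorem isLocalRing_iwasawaAlgebraTwoVar : IsLocalRing (PowerSeries (PowerSeries ℤ_[p])) :=
  inferInstance

/-- The clause `IsNoetherianRing R` for `R = Λ₂` (Mathlib instance, recorded). [cite: Greenberg2016Selmer, §1 p. 4 L5–10] -/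
theorem isNoetherianRing_iwasawaAlgebraTwoVar : IsNoetherianRing (PowerSeries (PowerSeries ℤ_[p])) :=
  inferInstance

/-- **The clause `IsAdicComplete (maximalIdeal R) R` for `R = Λ₂`**: `ℤ_p⟦T₂⟧⟦T₁⟧` is complete for
its maximal ideal `(p, T₁, T₂)` — the tree's `powerSeries_isAdicComplete_maximalIdeal` (power series
over a complete local ring are complete for the maximal ideal) applied twice over Mathlib's
`IsAdicComplete (maximalIdeal ℤ_[p]) ℤ_[p]`. [cite: Bourbaki1989CommAlg, Ch. III §2 no. 6, Prop. 6 and the remark following it]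
[cite: Greenberg2016Selmer, §1 p. 4 L5–10 (R is a complete Noetherian local ring)] -/
theorem isAdicComplete_maximalIdeal_iwasawaAlgebraTwoVar :
    IsAdicComplete (maximalIdeal (PowerSeries (PowerSeries ℤ_[p]))) (PowerSeries (PowerSeries ℤ_[p])) :=
  haveI : IsAdicComplete (maximalIdeal (PowerSeries ℤ_[p])) (PowerSeries ℤ_[p]) :=
    Literature.NumberTheory.GaloisRepresentations.powerSeries_isAdicComplete_maximalIdeal
  Literature.NumberTheory.GaloisRepresentations.powerSeries_isAdicComplete_maximalIdeal

/-- The clause `Nonempty (Λ ≃+* MvPowerSeries (Fin m) ℤ_[p])` for `Λ = Λ₂`, `m = 2`.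
[cite: Greenberg2016Selmer, §1 p. 4 L11–13] -/
theorem nonempty_iwasawaAlgebraTwoVar_ringEquiv_mvPowerSeries :
    Nonempty (PowerSeries (PowerSeries ℤ_[p]) ≃+* MvPowerSeries (Fin 2) ℤ_[p]) :=
  nonempty_ringEquiv_mvPowerSeries_fin_two ℤ_[p]

end Residue

end Literature.NumberTheory.IwasawaTheory
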